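import Summits.ValiantsHypothesis.ValiantsHypothesis.Theorems.LacunarySymmetroidMatrixDescartesCensusDoorA34NodeRows

/-!
# `MatrixDescartes` census — DOOR A at `(3,4)`: the TWO-NODE ROWS — `DoorA34` follows from a root bound for cubic forms
# that are BI-AFFINE in two node coordinates (rung 2 of the nodal ladder, stated as a sufficient condition)

HONEST FRAMING.  Object-search cell `pub-symmetroid`, door-A seat `val-sym-door-p3` (g19); item stmt-ValiantsHypothesis-19980
`DoorA34 = PosRootLawAt 3 4 18` is OPEN and asserted nowhere in this file.  The theorems are IMPLICATIONS: two explicit fewnomial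
row families (the «two-node rows») bound by `18` on a support `d` IMPLY the support row `PosRootLawOn 3 4 18 d`, and bound on every
support they imply `DoorA34`.  NEITHER family is bounded here (each has Descartes ceiling `19`); whether they are bounded by `18` is the
located question «N₂ ≤ 18?» of the nodal ladder (door-p3 g18 report §3, g19 kit job j315175).  Nothing bounds `ζ_sym(3,4)`; nothing bears
on `MatrixDescartes` (stmt-ValiantsHypothesis-18050) or on `VP ≠ VNP`.

CONTENT (all supports; no `def`, no `sorry`).  Write `N(c) = ∑_l C(c_l)·X^{d_l}` (node forms on the support `d`) and let
`L₀, L₁, L₂, L₃` be four node forms.  A real cubic form on `ℝ⁴` that is singular at two points `p ≠ q` contains the line `pq`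
(the line meets the surface with multiplicity `≥ 4 > 3`), and in coordinates with `p = e₀`, `q = e₁` it has NO monomial of degree
`≥ 2` in `y₀` or in `y₁`: it is BI-AFFINE, `F = y₀y₁·λ(y₂,y₃) + y₀·α(y₂,y₃) + y₁·β(y₂,y₃) + κ(y₂,y₃)` with binary forms
`λ, α, β, κ` of degrees `1, 2, 2, 3` (two REAL nodes), and for a complex-conjugate pair of nodes `e₀ ± i·e₁` it is
`F = (y₀²+y₁²)·λ + y₀·α + y₁·β + κ` (bi-affine in `z = y₀ + iy₁`, `z̄`).  Composing with node forms gives the two row families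
* (N2R) `L₀L₁(a₀L₂ + a₁L₃) + L₀(b₀L₂² + b₁L₂L₃ + b₂L₃²) + L₁(c₀L₂² + c₁L₂L₃ + c₂L₃²) + (e₀L₂³ + e₁L₂²L₃ + e₂L₂L₃² + e₃L₃³)`,
* (N2C) `(L₀²+L₁²)(a₀L₂ + a₁L₃) + L₀(b₀L₂² + …) + L₁(c₀L₂² + …) + (e₀L₂³ + …)`,
both `20`-nomials on `3D`.  Cayley's four-nodal cubic has `≥ 2` nodes in each real form: the node rows of `…NodeRows`
(`posRootLawOn_iff_nodeRows`) are the instances R4 `= N2R(a = (1,1), b = c = (0,1,0), e = 0)`, R2 `= N2R(a = (2,0), b = c = (1,0,1), e = 0)`,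
R0 `= N2C(a = (1,0), b = (1,0,1), c = 0, e = 0)`.  Hence
* **`posRootLawOn_of_twoNodeRows`** (every `d`): `Z₊ ≤ 18` on both two-node families on `d` ⟹ `PosRootLawOn 3 4 18 d`;
* **`doorA34_of_twoNodeRows`**: the same on every support ⟹ `DoorA34`.
READING.  «Two nodes (real, or a conjugate pair) already obstruct the Descartes ceiling `19`» is a STRONGER, codimension-two statement
than the door (codimension four); rung 1 is known NOT to obstruct (`Census.NodalNineteen01912.card_posRoots_eq`, an exact real-nodal
nineteen).  [folklore] the line through two double points of a cubic surface lies on it; elementary.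
-/

-- `Summit.ValiantsHypothesis.ValiantsHypothesis.…` repeats a component by the D-0017 layout
-- (single-conjunct summit), which the `dupNamespace` linter flags; the name is mandated.
set_option linter.dupNamespace false

namespace Summit.ValiantsHypothesis.ValiantsHypothesis.Theorems.LacunarySymmetroidMatrixDescartes.Census.NodalLadder

open Matrix Finset Polynomial
open scoped BigOperators

/-- Transport of a root bound along a polynomial identity (bookkeeping). [folklore] -/
theorem card_posRoots_le_of_eq {P Q : ℝ[X]} {B : ℕ} (h : P = Q)
    (hQ : (Q.roots.toFinset.filter (fun t => 0 < t)).card ≤ B) :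
    (P.roots.toFinset.filter (fun t => 0 < t)).card ≤ B := by
  subst h; exact hQ

/-- **RUNG 2 OF THE NODAL LADDER IMPLIES THE ROW `ζ(3,4; d) ≤ 18` (support level).**  Fix a support `d : Fin 4 → ℕ` and write
`N(c) = ∑_l C(c_l)X^{d_l}`.  Suppose that for all node forms `L₀, …, L₃` on `d` and all real coefficients
(N2R, two real nodes) `Z₊( L₀L₁(a₀L₂ + a₁L₃) + L₀(b₀L₂² + b₁L₂L₃ + b₂L₃²) + L₁(c₀L₂² + c₁L₂L₃ + c₂L₃²) + (e₀L₂³ + e₁L₂²L₃ + e₂L₂L₃² + e₃L₃³) ) ≤ 18`, and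
(N2C, a conjugate pair of nodes) `Z₊( (L₀² + L₁²)(a₀L₂ + a₁L₃) + L₀(b₀L₂² + …) + L₁(c₀L₂² + …) + (e₀L₂³ + …) ) ≤ 18`
— i.e. every real cubic form that is bi-affine in two real node coordinates, resp. in a conjugate pair of node coordinates, meets the
positive arc of every linearly transformed monomial curve `x ↦ (x^{d_l})` in at most `18` points.  Then `PosRootLawOn 3 4 18 d`:
every real symmetric `3 × 3` four-letter pencil on `d` has at most `18` distinct positive det-roots.  (Via `posRootLawOn_iff_nodeRows`:
the classes R4, R2 are instances of N2R and R0 of N2C.)  Neither hypothesis is proved anywhere; `DoorA34` stays OPEN. [folklore] -/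
theorem posRootLawOn_of_twoNodeRows (d : Fin 4 → ℕ)
    (hR : ∀ (ℓ : Fin 4 → Fin 4 → ℝ) (L : Fin 4 → ℝ[X]) (a : Fin 2 → ℝ) (b c : Fin 3 → ℝ) (e : Fin 4 → ℝ),
      (∀ j, L j = ∑ l, C (ℓ j l) * (X : ℝ[X]) ^ d l) →
      ((L 0 * L 1 * (C (a 0) * L 2 + C (a 1) * L 3)
        + L 0 * (C (b 0) * L 2 ^ 2 + C (b 1) * (L 2 * L 3) + C (b 2) * L 3 ^ 2)
        + L 1 * (C (c 0) * L 2 ^ 2 + C (c 1) * (L 2 * L 3) + C (c 2) * L 3 ^ 2)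
        + (C (e 0) * L 2 ^ 3 + C (e 1) * (L 2 ^ 2 * L 3) + C (e 2) * (L 2 * L 3 ^ 2) + C (e 3) * L 3 ^ 3)).roots.toFinset.filter
          (fun t => 0 < t)).card ≤ 18)
    (hC : ∀ (ℓ : Fin 4 → Fin 4 → ℝ) (L : Fin 4 → ℝ[X]) (a : Fin 2 → ℝ) (b c : Fin 3 → ℝ) (e : Fin 4 → ℝ),
      (∀ j, L j = ∑ l, C (ℓ j l) * (X : ℝ[X]) ^ d l) →
      (((L 0 ^ 2 + L 1 ^ 2) * (C (a 0) * L 2 + C (a 1) * L 3)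
        + L 0 * (C (b 0) * L 2 ^ 2 + C (b 1) * (L 2 * L 3) + C (b 2) * L 3 ^ 2)
        + L 1 * (C (c 0) * L 2 ^ 2 + C (c 1) * (L 2 * L 3) + C (c 2) * L 3 ^ 2)
        + (C (e 0) * L 2 ^ 3 + C (e 1) * (L 2 ^ 2 * L 3) + C (e 2) * (L 2 * L 3 ^ 2) + C (e 3) * L 3 ^ 3)).roots.toFinset.filter
          (fun t => 0 < t)).card ≤ 18) :
    PosRootLawOn 3 4 18 d := by
  refine (EqualDiagonal.posRootLawOn_iff_nodeRows d).mpr ⟨fun ℓ => ?_, fun p q ℓ => ?_, fun p q r s => ?_⟩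
  · -- R4 = N2R with `a = (1,1)`, `b = c = (0,1,0)`, `e = 0`
    refine card_posRoots_le_of_eq ?_
      (hR ℓ (fun j => ∑ l, C (ℓ j l) * (X : ℝ[X]) ^ d l) ![1, 1] ![0, 1, 0] ![0, 1, 0] ![0, 0, 0, 0] (fun j => rfl))
    rw [EqualDiagonal.e3_eq_sum_prod_erase]
    simp only [Matrix.cons_val_zero, Matrix.cons_val_one, Matrix.cons_val_two, Matrix.cons_val_three, Matrix.head_cons,
      Matrix.tail_cons, map_one, map_zero]
    ring
  · -- R2 = N2R with nodes `(L₀, L₁) = (N(ℓ 0), N(ℓ 1))`, `(L₂, L₃) = (P, Q)`, `a = (2,0)`, `b = c = (1,0,1)`, `e = 0`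
    refine card_posRoots_le_of_eq ?_
      (hR ![ℓ 0, ℓ 1, p, q] ![∑ l, C (ℓ 0 l) * (X : ℝ[X]) ^ d l, ∑ l, C (ℓ 1 l) * (X : ℝ[X]) ^ d l,
          ∑ l, C (p l) * (X : ℝ[X]) ^ d l, ∑ l, C (q l) * (X : ℝ[X]) ^ d l]
        ![2, 0] ![1, 0, 1] ![1, 0, 1] ![0, 0, 0, 0] (fun j => by fin_cases j <;> rfl))
    simp only [Matrix.cons_val_zero, Matrix.cons_val_one, Matrix.cons_val_two, Matrix.cons_val_three, Matrix.head_cons,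
      Matrix.tail_cons, map_one, map_zero, map_ofNat]
    ring
  · -- R0 = N2C with the pair `(L₀, L₁) = (R, S)`, `(L₂, L₃) = (P, Q)`, `a = (1,0)`, `b = (1,0,1)`, `c = 0`, `e = 0`
    refine card_posRoots_le_of_eq ?_
      (hC ![r, s, p, q] ![∑ l, C (r l) * (X : ℝ[X]) ^ d l, ∑ l, C (s l) * (X : ℝ[X]) ^ d l,
          ∑ l, C (p l) * (X : ℝ[X]) ^ d l, ∑ l, C (q l) * (X : ℝ[X]) ^ d l]
        ![1, 0] ![1, 0, 1] ![0, 0, 0] ![0, 0, 0, 0] (fun j => by fin_cases j <;> rfl))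
    simp only [Matrix.cons_val_zero, Matrix.cons_val_one, Matrix.cons_val_two, Matrix.cons_val_three, Matrix.head_cons,
      Matrix.tail_cons, map_one, map_zero]
    ring

/-- **RUNG 2 OF THE NODAL LADDER IMPLIES `DoorA34` (format level).**  If on EVERY support `d` both two-node row families — (N2R) cubic
forms bi-affine in two real node coordinates and (N2C) cubic forms bi-affine in a conjugate pair of node coordinates, composed with four
node forms on `d` (see `posRootLawOn_of_twoNodeRows`) — have at most `18` distinct positive roots, then `DoorA34 = PosRootLawAt 3 4 18`
(the typed target `Iff.rfl`-equal to the route item `Theses.LacunarySymmetroid.DoorA34`, stmt-ValiantsHypothesis-19980) holds.  «Two nodes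
obstruct `19`» is STRONGER than the door (Cayley's symmetroid has four nodes) and is NOT proved anywhere; one node does not obstruct
(`Census.NodalNineteen01912.card_posRoots_eq`).  `DoorA34` stays OPEN; `ζ_sym(3,4) ∈ {18, 19}`. [folklore] -/
theorem doorA34_of_twoNodeRows
    (hR : ∀ (d : Fin 4 → ℕ) (ℓ : Fin 4 → Fin 4 → ℝ) (L : Fin 4 → ℝ[X]) (a : Fin 2 → ℝ) (b c : Fin 3 → ℝ) (e : Fin 4 → ℝ),
      (∀ j, L j = ∑ l, C (ℓ j l) * (X : ℝ[X]) ^ d l) →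
      ((L 0 * L 1 * (C (a 0) * L 2 + C (a 1) * L 3)
        + L 0 * (C (b 0) * L 2 ^ 2 + C (b 1) * (L 2 * L 3) + C (b 2) * L 3 ^ 2)
        + L 1 * (C (c 0) * L 2 ^ 2 + C (c 1) * (L 2 * L 3) + C (c 2) * L 3 ^ 2)
        + (C (e 0) * L 2 ^ 3 + C (e 1) * (L 2 ^ 2 * L 3) + C (e 2) * (L 2 * L 3 ^ 2) + C (e 3) * L 3 ^ 3)).roots.toFinset.filter
          (fun t => 0 < t)).card ≤ 18)
    (hC : ∀ (d : Fin 4 → ℕ) (ℓ : Fin 4 → Fin 4 → ℝ) (L : Fin 4 → ℝ[X]) (a : Fin 2 → ℝ) (b c : Fin 3 → ℝ) (e : Fin 4 → ℝ),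
      (∀ j, L j = ∑ l, C (ℓ j l) * (X : ℝ[X]) ^ d l) →
      (((L 0 ^ 2 + L 1 ^ 2) * (C (a 0) * L 2 + C (a 1) * L 3)
        + L 0 * (C (b 0) * L 2 ^ 2 + C (b 1) * (L 2 * L 3) + C (b 2) * L 3 ^ 2)
        + L 1 * (C (c 0) * L 2 ^ 2 + C (c 1) * (L 2 * L 3) + C (c 2) * L 3 ^ 2)
        + (C (e 0) * L 2 ^ 3 + C (e 1) * (L 2 ^ 2 * L 3) + C (e 2) * (L 2 * L 3 ^ 2) + C (e 3) * L 3 ^ 3)).roots.toFinset.filter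
          (fun t => 0 < t)).card ≤ 18) :
    DoorA34 :=
  fun d => posRootLawOn_of_twoNodeRows d (hR d) (hC d)

end Summit.ValiantsHypothesis.ValiantsHypothesis.Theorems.LacunarySymmetroidMatrixDescartes.Census.NodalLadder
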